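import Summits.QuantumFields.BalabanUV.T4Continuum.Support.DirichletStarSiblingClasses

/-!
# T⁴ programme, spine node NE2 (U1a), sub-row Δ1 «NE2⁰-Dirichlet» — THE CLASS POINCARÉ INEQUALITY ON THE STAR CARRIERS
# (supplier item «Δ1-VEC-CLASS-POINCARÉ», owner rulings R27 (b) / R28 (c), file 2 of 2): the `hP` socket of
# `DirichletStarRenormTower.poincareForm_of_sockets` DISCHARGED with the `d`-FREE constant `CP = 1/2` —
# `‖(1 − J̃J̃ᴴ)w‖² ≤ ((L−1)L/2)·n_{k+1}^{−2}·Σ_μ ‖igrad_μ w‖² ≤ (1/2)·L²·n_{k+1}^{−2}·Σ_μ ‖igrad_μ w‖²` — hence PF and the TORUS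
# RATE `L⁻¹` of the defect-free star tower of `Δ_a(Ω₀)` from the INTERIOR gradient-form bound alone (modulo W1, W3̃)

NE2 formalisation swarm `b2b-balaban-t4-ne2-formalise-*`, LEAF PROVER 07 (gen 7), file 2 on file 1 `Support/DirichletStarSiblingClasses`
(the sibling classes `cls i` of the star carriers charted from the cube `Fin d → Fin L` by `chart i`, multiplicity `mult i`, the cube
brick `cube_poincare`) and the owner's (t4-ne2-p1 gen 13) `Support/DirichletSubregionRenormTower` (p228571) /
`Support/DirichletStarRenormTower` (p228905):

 * §3 `J̃J̃ᴴ` is the CLASS-MEAN projector (**`proj_mulVec`**: `(J̃J̃ᴴw) y = (nch (parT y))⁻¹·Σ_{siblings} w`), so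
   `nsq ((1 − J̃J̃ᴴ)w) = Σ_i Σ_{y ∈ cls i} ‖w y − cmean w i‖²` (`nsq_proj_eq`); the cube mean of `w ∘ chart i` is the class mean
   (`cube_mean_eq`); an in-cube bond costs at most the interior difference at its foot (**`bond_le`**:
   `‖w (chart i (bump j μ)) − w (chart i j)‖² ≤ n_{k+1}^{−2}·‖igrad_μ w (chart i j)‖²`, equality on regular bonds, `0 ≤ …` on the
   degenerate `ν`-bonds of a layer chart); the per-class inequality **`class_poincare`** (cube brick through the chart, divided by the
   multiplicity); the ENDs **`nsq_proj_le_sharp`** (constant `((L−1)L/2)·n_{k+1}^{−2}`), **`nsq_proj_le`** — the owner's target shape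
   `∀ k w, nsq ((1 − JnR k·(JnR k)ᴴ) *ᵥ w) ≤ CP·L²·n_{k+1}^{−2}·Σ_μ nsq (igrad M S (lev L (k+1)) μ w)` VERBATIM with `CP = 1/2`, free
   of `d` — and `nsq_proj_le_lev` (`= (1/2)·n_k^{−2}·Σ_μ …`);
 * §4 read-outs through the owner's sockets: **`poincareForm_of_interior`** (PF ⇐ the interior gradient-form bound ALONE, via
   `poincareForm_of_sockets`, `E_k = (1/2)·L²·n_{k+1}^{−2}·CgI`) and **`towerLimitRate_star_renorm_of_interior`** = the owner's
   `towerLimitRate_star_renorm_of_sq` with `hPF` DISCHARGED from ONE level-uniform interior constant `CgI` (`E_k = (CgI/2)·(L⁻¹)^{2k}`):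
   the defect-free star tower of the faithful `Δ_a(Ω₀)` converges at the TORUS RATE `L⁻¹` modulo W1 (`hS`, one slice constant) +
   interior W2 (`hI`) + W3̃ (`hinj`), constant `Cpert 0 √(CgI/2·γ⋆⁻¹) C₁ 0 0 0`.

HONEST FRAMING (T4-DAG p. 1).  Lattice geometry and bookkeeping at MODEL level (`U = 1`, ONE region, ONE averaging scale, finite
torus, linear layer, operator norm); statements / constants OURS ([folklore]); this file discharges ONE of PF's two sockets — the
interior gradient-form bound (interior W2), W1 (one slice constant uniformly in the region: the crew's located open estimate
G-ne2leaf07g5-1) and W3̃ stay DISPLAYED; NE2 (U1a) NOT proved; spine 0/9 unchanged; NOT [B9] (3.16)/(3.23)–(3.27) as printed; NOT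
infinite volume, NOT a mass gap, NOT the Clay problem, NOT summit progress.  HONEST DEPENDENCY: continuum YM on T⁴ ⇐ BetaPertH ∧
nine spine estimates (0/9 proved); BetaPertH ⇐ (D1) ∧ (D4) ∧ CAP+tail; G-an2-4 gates asym, D1 and NE2/3/4.  No `sorry`.
-/

noncomputable section

open scoped BigOperators ComplexConjugate Matrix Matrix.Norms.L2Operator
open Finset

namespace Summit.QuantumFields.BalabanUV.T4Continuum.DirichletStarClassPoincare

open Literature.MathematicalPhysics.QuantumFieldTheory.Balaban1983to89.B5Prop11Plancherel (Tor fine unitVec)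
open Literature.MathematicalPhysics.QuantumFieldTheory.Balaban1983to89.B5Prop11Lower (nsq nsq_nonneg)
open Literature.MathematicalPhysics.QuantumFieldTheory.Balaban1983to89.B5G183RateUnitTower (lev)
open Summit.QuantumFields.BalabanUV.T4Continuum
open Summit.QuantumFields.BalabanUV.T4Continuum.CovariantAveragingTower (TowerLimitRate)
open Summit.QuantumFields.BalabanUV.T4Continuum.BalabanAveragedTowerUnit (idx cast_lev')
open Summit.QuantumFields.BalabanUV.T4Continuum.BackgroundResolventTower
open Summit.QuantumFields.BalabanUV.T4Continuum.BlockPairingGeometry (parT)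
open Summit.QuantumFields.BalabanUV.T4Continuum.SubtypeCompression
open Summit.QuantumFields.BalabanUV.T4Continuum.RegionGaugeSlice (SliceCoercive)
open Summit.QuantumFields.BalabanUV.T4Continuum.RegionScalarCompression (QOm GOm)
open Summit.QuantumFields.BalabanUV.T4Continuum.RegionGaugeFixedVector (starReg curlR gradR avgR regionDeltaA)
open Summit.QuantumFields.BalabanUV.T4Continuum.DirichletSubregionTowerOf (pidx)
open Summit.QuantumFields.BalabanUV.T4Continuum.DirichletSubregionRenormTower (nch JnR AnR)
open Summit.QuantumFields.BalabanUV.T4Continuum.DirichletStarVectorTower (starP star_down gamStar)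
open Summit.QuantumFields.BalabanUV.T4Continuum.DirichletStarRenormTower (igrad poincareForm_of_sockets
  towerLimitRate_star_renorm_of_sq)
open Summit.QuantumFields.BalabanUV.T4Continuum.DirichletStarSiblingClasses
open Summit.QuantumFields.BalabanUV.Beta.GAN24.DirichletBoxTrace (blockReg)

variable {d : ℕ}

/-! ## §3 `J̃J̃ᴴ` is the class-mean projector; the per-class inequality; the ENDs -/

section Classes

variable (L : ℕ) [NeZero L] (M : Fin d → ℕ) [hM : ∀ μ, NeZero (M μ)] (S : Tor M → Prop) [DecidablePred S]

/-- the parent of a star carrier as a level-`k` star carrier (`star_down`). [folklore] -/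
def prt (k : ℕ) (y : pidx L M (starP L M S) (k + 1)) : pidx L M (starP L M S) k :=
  ⟨parT (lev L k) L M y.1, star_down L M S k y.1 y.2⟩

/-- THE CLASS MEAN of `w` over the sibling class of `i`. [folklore] -/
def cmean (k : ℕ) (w : pidx L M (starP L M S) (k + 1) → ℂ) (i : pidx L M (starP L M S) k) : ℂ :=
  ((nch L M (starP L M S) k i.1 : ℂ))⁻¹ * ∑ y ∈ cls L M S k i, w y

/-- the interior difference read through a `+e_μ` neighbour: `igrad_μ w y = n·(w y′ − w y)` when `y′ = y + e_μ`. [folklore] -/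
theorem igrad_eq_of_succ (n : ℕ) [NeZero n] (μ : Fin d) (w : {b // starReg n M S b} → ℂ) (y y' : {b // starReg n M S b})
    (h : y'.1 = (y.1.1 + unitVec (fine n M) μ, y.1.2)) : igrad M S n μ w y = (n : ℂ) * (w y' - w y) := by
  have hmem : starReg n M S (y.1.1 + unitVec (fine n M) μ, y.1.2) := h ▸ y'.2
  unfold igrad
  rw [dif_pos hmem]
  congr 2
  exact congrArg w (Subtype.ext h.symm)

/-- **`J̃J̃ᴴ` IS THE CLASS-MEAN PROJECTOR**: `(J̃J̃ᴴw) y = ` the mean of `w` over the siblings of `y`. [folklore] -/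
theorem proj_mulVec (k : ℕ) (w : pidx L M (starP L M S) (k + 1) → ℂ) (y : pidx L M (starP L M S) (k + 1)) :
    ((JnR L M (starP L M S) k * (JnR L M (starP L M S) k)ᴴ) *ᵥ w) y = cmean L M S k w (prt L M S k y) := by
  rw [← Matrix.mulVec_mulVec]
  have h1 : ∀ v : pidx L M (starP L M S) k → ℂ, (JnR L M (starP L M S) k *ᵥ v) y
      = (((Real.sqrt (nch L M (starP L M S) k (prt L M S k y).1))⁻¹ : ℝ) : ℂ) * v (prt L M S k y) := by
    intro v
    simp only [Matrix.mulVec, dotProduct, JnR]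
    rw [Finset.sum_eq_single (prt L M S k y)]
    · rw [if_pos (show parT (lev L k) L M y.1 = (prt L M S k y).1 from rfl)]
    · intro i _ hi
      rw [if_neg, zero_mul]
      intro h
      exact hi (Subtype.ext h).symm
    · intro h; exact absurd (mem_univ _) h
  have h2 : ∀ i : pidx L M (starP L M S) k, ((JnR L M (starP L M S) k)ᴴ *ᵥ w) i
      = (((Real.sqrt (nch L M (starP L M S) k i.1))⁻¹ : ℝ) : ℂ) * ∑ y' ∈ cls L M S k i, w y' := by
    intro i
    simp only [Matrix.mulVec, dotProduct, Matrix.conjTranspose_apply, JnR]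
    rw [cls, sum_filter, mul_sum]
    refine sum_congr rfl fun y' _ => ?_
    split_ifs with h
    · rw [Complex.star_def, Complex.conj_ofReal]
    · rw [star_zero, zero_mul, mul_zero]
  rw [h1, h2, ← mul_assoc, cmean]
  congr 1
  rw [← Complex.ofReal_mul, ← mul_inv, Real.mul_self_sqrt (Nat.cast_nonneg _), Complex.ofReal_inv, Complex.ofReal_natCast]

/-- **`nsq ((1 − J̃J̃ᴴ)w)` CLASS BY CLASS**: `= Σ_i Σ_{y ∈ cls i} ‖w y − cmean w i‖²`. [folklore] -/
theorem nsq_proj_eq (k : ℕ) (w : pidx L M (starP L M S) (k + 1) → ℂ) :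
    nsq ((1 - JnR L M (starP L M S) k * (JnR L M (starP L M S) k)ᴴ) *ᵥ w)
      = ∑ i : pidx L M (starP L M S) k, ∑ y ∈ cls L M S k i, ‖w y - cmean L M S k w i‖ ^ 2 := by
  unfold nsq
  rw [← sum_fiberwise_of_maps_to (s := univ) (t := univ) (g := prt L M S k) (fun _ _ => mem_univ _)]
  refine sum_congr rfl fun i _ => ?_
  have hf : univ.filter (fun y => prt L M S k y = i) = cls L M S k i := by
    ext y
    simp only [cls, mem_filter, mem_univ, true_and, prt, Subtype.ext_iff]
  rw [hf]
  refine sum_congr rfl fun y hy => ?_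
  have hp : prt L M S k y = i := Subtype.ext (mem_filter.mp hy).2
  rw [Matrix.sub_mulVec, Matrix.one_mulVec, Pi.sub_apply, proj_mulVec, hp]

/-- the cube mean of `w ∘ chart i` is the class mean. [folklore] -/
theorem cube_mean_eq (k : ℕ) (w : pidx L M (starP L M S) (k + 1) → ℂ) (i : pidx L M (starP L M S) k) :
    (∑ j, w (chart L M S k i j)) / (Fintype.card (Fin d → Fin L) : ℂ) = cmean L M S k w i := by
  have hm : ((mult L M S k i : ℕ) : ℂ) ≠ 0 := by exact_mod_cast (mult_pos L M S k i).ne'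
  rw [sum_chart L M S k i (fun y => w y), card_cube L M S k i, nsmul_eq_mul, Nat.cast_mul, mul_div_mul_left _ _ hm, cmean,
    div_eq_inv_mul]

/-- **IN-CUBE BOND ≤ INTERIOR DIFFERENCE**: `‖F (bump j μ) − F j‖² ≤ n_{k+1}^{−2}·‖igrad_μ w (chart i j)‖²` for `F = w ∘ chart i` and
`j_μ + 1 < L` (equality on regular bonds, `0 ≤ …` on the degenerate `ν`-bonds of a layer chart). [folklore] -/
theorem bond_le (k : ℕ) (w : pidx L M (starP L M S) (k + 1) → ℂ) (i : pidx L M (starP L M S) k) (μ : Fin d)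
    (j : Fin d → Fin L) (hj : (j μ : ℕ) + 1 < L) :
    ‖w (chart L M S k i (bump L j μ)) - w (chart L M S k i j)‖ ^ 2
      ≤ ((((lev L (k + 1) : ℕ) : ℝ)) ^ 2)⁻¹ * ‖igrad M S (lev L (k + 1)) μ w (chart L M S k i j)‖ ^ 2 := by
  have hn : (0 : ℝ) < ((lev L (k + 1) : ℕ) : ℝ) := by exact_mod_cast Nat.pos_of_ne_zero (NeZero.ne _)
  by_cases hdeg : ¬ blockReg (lev L k) M S i.1.1 ∧ μ = i.1.2
  · have e : chart L M S k i (bump L j μ) = chart L M S k i j := by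
      apply Subtype.ext
      show child L M k i.1 (adj L M S k i (bump L j μ)) = child L M k i.1 (adj L M S k i j)
      rw [hdeg.2, adj_bump_deg L M S hdeg.1]
    rw [e, sub_self, norm_zero, zero_pow two_ne_zero]
    positivity
  · rw [igrad_eq_of_succ M S (lev L (k + 1)) μ w _ _ (chart_bump_fst L M S hdeg hj), norm_mul, mul_pow, Complex.norm_natCast,
      ← mul_assoc, inv_mul_cancel₀ (pow_pos hn 2).ne', one_mul]

/-- **THE PER-CLASS POINCARÉ INEQUALITY**: `Σ_{y ∈ cls i} ‖w y − cmean‖² ≤ ((L−1)L/2)·n_{k+1}^{−2}·Σ_μ Σ_{y ∈ cls i} ‖igrad_μ w y‖²`.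
[folklore] -/
theorem class_poincare (k : ℕ) (w : pidx L M (starP L M S) (k + 1) → ℂ) (i : pidx L M (starP L M S) k) :
    ∑ y ∈ cls L M S k i, ‖w y - cmean L M S k w i‖ ^ 2
      ≤ ((L : ℝ) - 1) * L / 2 * ((((lev L (k + 1) : ℕ) : ℝ)) ^ 2)⁻¹ *
          ∑ μ : Fin d, ∑ y ∈ cls L M S k i, ‖igrad M S (lev L (k + 1)) μ w y‖ ^ 2 := by
  set m : ℝ := (mult L M S k i : ℝ) with hm
  have hm0 : 0 < m := by rw [hm]; exact_mod_cast mult_pos L M S k i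
  have hL : 0 ≤ ((L : ℝ) - 1) * L / 2 := by
    have : (1 : ℝ) ≤ L := by exact_mod_cast Nat.pos_of_ne_zero (NeZero.ne L)
    have : (0 : ℝ) ≤ (L : ℝ) - 1 := by linarith
    positivity
  -- the class sum, read on the cube
  have lhs : m * ∑ y ∈ cls L M S k i, ‖w y - cmean L M S k w i‖ ^ 2
      = ∑ j, ‖w (chart L M S k i j) - (∑ j, w (chart L M S k i j)) / (Fintype.card (Fin d → Fin L) : ℂ)‖ ^ 2 := by
    rw [cube_mean_eq, sum_chart L M S k i (fun y => ‖w y - cmean L M S k w i‖ ^ 2), nsmul_eq_mul]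
  -- the in-cube bonds, read on the class
  have rhs : ∀ μ : Fin d, ∑ j ∈ univ.filter (fun j : Fin d → Fin L => (j μ : ℕ) + 1 < L),
      ‖w (chart L M S k i (bump L j μ)) - w (chart L M S k i j)‖ ^ 2
        ≤ ((((lev L (k + 1) : ℕ) : ℝ)) ^ 2)⁻¹ * (m * ∑ y ∈ cls L M S k i, ‖igrad M S (lev L (k + 1)) μ w y‖ ^ 2) := by
    intro μ
    calc ∑ j ∈ univ.filter (fun j : Fin d → Fin L => (j μ : ℕ) + 1 < L),
          ‖w (chart L M S k i (bump L j μ)) - w (chart L M S k i j)‖ ^ 2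
        ≤ ∑ j ∈ univ.filter (fun j : Fin d → Fin L => (j μ : ℕ) + 1 < L),
            ((((lev L (k + 1) : ℕ) : ℝ)) ^ 2)⁻¹ * ‖igrad M S (lev L (k + 1)) μ w (chart L M S k i j)‖ ^ 2 :=
          sum_le_sum fun j hj => bond_le L M S k w i μ j (mem_filter.mp hj).2
      _ ≤ ∑ j, ((((lev L (k + 1) : ℕ) : ℝ)) ^ 2)⁻¹ * ‖igrad M S (lev L (k + 1)) μ w (chart L M S k i j)‖ ^ 2 :=
          sum_le_sum_of_subset_of_nonneg (filter_subset _ _) fun j _ _ => by positivity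
      _ = ((((lev L (k + 1) : ℕ) : ℝ)) ^ 2)⁻¹ * (m * ∑ y ∈ cls L M S k i, ‖igrad M S (lev L (k + 1)) μ w y‖ ^ 2) := by
          rw [← mul_sum, sum_chart L M S k i (fun y => ‖igrad M S (lev L (k + 1)) μ w y‖ ^ 2), nsmul_eq_mul]
  have h := (cube_poincare L d fun j => w (chart L M S k i j)).trans
    (mul_le_mul_of_nonneg_left (sum_le_sum fun μ _ => rhs μ) hL)
  rw [← lhs, ← mul_sum, ← mul_sum, ← mul_assoc] at h
  -- divide by the multiplicity
  have h' : m * ∑ y ∈ cls L M S k i, ‖w y - cmean L M S k w i‖ ^ 2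
      ≤ m * (((L : ℝ) - 1) * L / 2 * ((((lev L (k + 1) : ℕ) : ℝ)) ^ 2)⁻¹ *
          ∑ μ : Fin d, ∑ y ∈ cls L M S k i, ‖igrad M S (lev L (k + 1)) μ w y‖ ^ 2) := by
    refine h.trans (le_of_eq ?_); ring
  exact le_of_mul_le_mul_left h' hm0

/-- **THE CLASS POINCARÉ INEQUALITY ON THE STAR CARRIERS, sharp form**: for every `k` and every `w`,
`nsq ((1 − J̃J̃ᴴ)w) ≤ ((L−1)L/2)·n_{k+1}^{−2}·Σ_μ nsq (igrad_μ w)`. [folklore] -/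
theorem nsq_proj_le_sharp (k : ℕ) (w : pidx L M (starP L M S) (k + 1) → ℂ) :
    nsq ((1 - JnR L M (starP L M S) k * (JnR L M (starP L M S) k)ᴴ) *ᵥ w)
      ≤ ((L : ℝ) - 1) * L / 2 * ((((lev L (k + 1) : ℕ) : ℝ)) ^ 2)⁻¹ * ∑ μ, nsq (igrad M S (lev L (k + 1)) μ w) := by
  rw [nsq_proj_eq]
  refine (sum_le_sum fun i _ => class_poincare L M S k w i).trans (le_of_eq ?_)
  rw [← mul_sum, sum_comm]
  congr 1
  refine sum_congr rfl fun μ _ => ?_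
  unfold nsq
  rw [← sum_fiberwise_of_maps_to (s := univ) (t := univ) (g := prt L M S k) (fun _ _ => mem_univ _)]
  refine sum_congr rfl fun i _ => ?_
  have hf : univ.filter (fun y => prt L M S k y = i) = cls L M S k i := by
    ext y
    simp only [cls, mem_filter, mem_univ, true_and, prt, Subtype.ext_iff]
  rw [hf]

/-- **THE CLASS POINCARÉ INEQUALITY — the owner's target shape** (R27 (b) / R28 (c)) **with `CP = 1/2`, free of `d`**:
`nsq ((1 − J̃J̃ᴴ)w) ≤ (1/2)·L²·n_{k+1}^{−2}·Σ_μ nsq (igrad_μ w)`. [folklore] -/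
theorem nsq_proj_le (k : ℕ) (w : pidx L M (starP L M S) (k + 1) → ℂ) :
    nsq ((1 - JnR L M (starP L M S) k * (JnR L M (starP L M S) k)ᴴ) *ᵥ w)
      ≤ 1 / 2 * (L : ℝ) ^ 2 * ((((lev L (k + 1) : ℕ) : ℝ)) ^ 2)⁻¹ * ∑ μ, nsq (igrad M S (lev L (k + 1)) μ w) := by
  refine (nsq_proj_le_sharp L M S k w).trans (mul_le_mul_of_nonneg_right ?_ (sum_nonneg fun _ _ => nsq_nonneg _))
  refine mul_le_mul_of_nonneg_right ?_ (by positivity)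
  nlinarith [Nat.cast_nonneg (α := ℝ) L]

omit [NeZero L] in
/-- `L²·(L^k·L)^{−2} = (L^k)^{−2}`. [folklore] -/
theorem sq_mul_inv_sq (hL : (L : ℝ) ≠ 0) (k : ℕ) :
    (L : ℝ) ^ 2 * ((((L : ℝ) ^ k * L) ^ 2))⁻¹ = ((((L : ℝ) ^ k) ^ 2))⁻¹ := by
  rw [mul_pow, mul_inv, mul_comm ((((L : ℝ) ^ k) ^ 2)⁻¹), ← mul_assoc, mul_inv_cancel₀ (pow_ne_zero 2 hL), one_mul]

/-- the same in level-`k` currency: `L²·n_{k+1}^{−2} = n_k^{−2}`. [folklore] -/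
theorem nsq_proj_le_lev (k : ℕ) (w : pidx L M (starP L M S) (k + 1) → ℂ) :
    nsq ((1 - JnR L M (starP L M S) k * (JnR L M (starP L M S) k)ᴴ) *ᵥ w)
      ≤ 1 / 2 * ((((lev L k : ℕ) : ℝ)) ^ 2)⁻¹ * ∑ μ, nsq (igrad M S (lev L (k + 1)) μ w) := by
  have hL : (L : ℝ) ≠ 0 := by exact_mod_cast NeZero.ne L
  refine (nsq_proj_le L M S k w).trans (le_of_eq ?_)
  rw [cast_lev' L (k + 1), cast_lev' L k, pow_succ (L : ℝ) k, mul_assoc (1 / 2 : ℝ) ((L : ℝ) ^ 2), sq_mul_inv_sq L hL k]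

end Classes

/-! ## §4 Read-outs through the owner's sockets: PF and the torus rate from the INTERIOR gradient-form bound alone -/

section End

variable (L : ℕ) [NeZero L] (M : Fin d → ℕ) [hM : ∀ μ, NeZero (M μ)] (S : Tor M → Prop) [DecidablePred S]

/-- **PF FROM THE INTERIOR GRADIENT-FORM BOUND ALONE** (the class Poincaré socket of `poincareForm_of_sockets` discharged):
`Σ_μ ‖igrad_μ w‖² ≤ CgI·Re⟨w, D w⟩` ⟹ `‖(1 − J̃J̃ᴴ)w‖² ≤ (1/2)·L²·n_{k+1}^{−2}·CgI·Re⟨w, D w⟩`. [folklore] -/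
theorem poincareForm_of_interior (k : ℕ)
    (D : Matrix (pidx L M (starP L M S) (k + 1)) (pidx L M (starP L M S) (k + 1)) ℂ) {CgI : ℝ}
    (hI : ∀ w : pidx L M (starP L M S) (k + 1) → ℂ,
      ∑ μ, nsq (igrad M S (lev L (k + 1)) μ w) ≤ CgI * (star w ⬝ᵥ (D *ᵥ w)).re)
    (w : pidx L M (starP L M S) (k + 1) → ℂ) :
    nsq ((1 - JnR L M (starP L M S) k * (JnR L M (starP L M S) k)ᴴ) *ᵥ w)
      ≤ 1 / 2 * (L : ℝ) ^ 2 * ((((lev L (k + 1) : ℕ) : ℝ)) ^ 2)⁻¹ * CgI * (star w ⬝ᵥ (D *ᵥ w)).re :=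
  poincareForm_of_sockets L M S k D (by positivity) (nsq_proj_le L M S k) hI w

variable (a a' : ℝ)

/-- **THE TORUS RATE `L⁻¹` FOR THE DEFECT-FREE STAR TOWER OF `Δ_a(Ω₀)` MODULO W1 + INTERIOR W2 + W3̃** — the owner's
`towerLimitRate_star_renorm_of_sq` with `hPF` DISCHARGED by this file from ONE level-uniform interior gradient-form constant `CgI`
(`E_k = (1/2)·L²·n_{k+1}^{−2}·CgI = (CgI/2)·(L⁻¹)^{2k}`).  DISPLAYED: W1 `hS` (one slice constant), interior W2 `hI`, W3̃ `hinj`. [folklore] -/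
theorem towerLimitRate_star_renorm_of_interior (ha' : 0 < a') {c : ℝ} (hc : 0 < c)
    (hS : ∀ k, SliceCoercive (curlR (lev L k) M S) (gradR (lev L k) M S) (GOm (lev L k) M a' S) (QOm (lev L k) M S)
      (avgR (lev L k) M S) (a * ((lev L k : ℕ) : ℝ) ^ d) c)
    {CgI : ℝ} (hCgI : 0 ≤ CgI)
    (hI : ∀ (k : ℕ) (w : pidx L M (starP L M S) (k + 1) → ℂ),
      ∑ μ, nsq (igrad M S (lev L (k + 1)) μ w) ≤ CgI * (star w ⬝ᵥ (regionDeltaA (lev L (k + 1)) M a a' S *ᵥ w)).re)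
    (hL : 2 ≤ L) {C₁ : ℝ}
    (hinj : ∀ k, ‖(regionDeltaA (lev L (k + 1)) M a a' S)⁻¹ * JnR L M (starP L M S) k
        - JnR L M (starP L M S) k * (regionDeltaA (lev L k) M a a' S)⁻¹‖ ≤ C₁ * ((L : ℝ)⁻¹) ^ k) :
    TowerLimitRate (AnR L M (starP L M S)) ((L : ℝ) ^ d) (fun k => (regionDeltaA (lev L k) M a a' S)⁻¹)
      (Cpert 0 (Real.sqrt (CgI / 2 * (gamStar d a' c)⁻¹)) C₁ 0 0 0) ((L : ℝ)⁻¹) := by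
  have hL0 : (L : ℝ) ≠ 0 := by exact_mod_cast NeZero.ne L
  set E : ℕ → ℝ := fun k => 1 / 2 * (L : ℝ) ^ 2 * ((((lev L (k + 1) : ℕ) : ℝ)) ^ 2)⁻¹ * CgI with hEdef
  have hE : ∀ k, 0 ≤ E k := fun k => by positivity
  have hE₀ : ∀ k, E k ≤ CgI / 2 * ((((L : ℝ)⁻¹) ^ k)) ^ 2 := by
    intro k
    refine le_of_eq ?_
    simp only [hEdef]
    rw [cast_lev' L (k + 1), inv_pow, inv_pow, pow_succ (L : ℝ) k, mul_assoc (1 / 2 : ℝ) ((L : ℝ) ^ 2), sq_mul_inv_sq L hL0 k]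
    ring
  exact towerLimitRate_star_renorm_of_sq L M S a a' ha' hc hS hE hE₀
    (fun k w => poincareForm_of_interior L M S k _ (hI k) w) hL hinj

/-- **THE GROWTH CLASS OF THE INTERIOR CONSTANT** (v1.1): if the interior gradient-form constant of level `k` grows at most like
`CgI_k ≤ CgI₀·((L·θ)^k)²` for some `0 ≤ θ < 1` (e.g. `θ = L^{−2/3}` for a corner class `CgI_k ≍ L^{2k/3}`; `θ = L⁻¹` for a level-uniform
constant) and the injected law W3̃ holds at rate `θ`, the defect-free star tower of `Δ_a(Ω₀)` converges at rate `θ` with constant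
`Cpert 0 √(CgI₀/2·γ⋆⁻¹) C₁ 0 0 0` — the owner's `towerLimitRate_star_renorm_of` with `hPF` DISCHARGED and `h₀` computed
(`E_k·γ⋆⁻¹ = (1/2)·n_k^{−2}·CgI_k·γ⋆⁻¹ ≤ (CgI₀/2·γ⋆⁻¹)·θ^{2k}`).  DISPLAYED: W1 `hS`, interior W2 `hI` (level-dependent `CgI k` in the class
`hCg`), W3̃ `hinj`. [folklore] -/
theorem towerLimitRate_star_renorm_of_interior_class (ha' : 0 < a') {c : ℝ} (hc : 0 < c)
    (hS : ∀ k, SliceCoercive (curlR (lev L k) M S) (gradR (lev L k) M S) (GOm (lev L k) M a' S) (QOm (lev L k) M S)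
      (avgR (lev L k) M S) (a * ((lev L k : ℕ) : ℝ) ^ d) c)
    {CgI : ℕ → ℝ} {CgI₀ θ : ℝ} (hθ0 : 0 ≤ θ) (hθ1 : θ < 1) (hCg0 : ∀ k, 0 ≤ CgI k)
    (hCg : ∀ k, CgI k ≤ CgI₀ * (((L : ℝ) * θ) ^ k) ^ 2)
    (hI : ∀ (k : ℕ) (w : pidx L M (starP L M S) (k + 1) → ℂ),
      ∑ μ, nsq (igrad M S (lev L (k + 1)) μ w) ≤ CgI k * (star w ⬝ᵥ (regionDeltaA (lev L (k + 1)) M a a' S *ᵥ w)).re)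
    {C₁ : ℝ}
    (hinj : ∀ k, ‖(regionDeltaA (lev L (k + 1)) M a a' S)⁻¹ * JnR L M (starP L M S) k
        - JnR L M (starP L M S) k * (regionDeltaA (lev L k) M a a' S)⁻¹‖ ≤ C₁ * θ ^ k) :
    TowerLimitRate (AnR L M (starP L M S)) ((L : ℝ) ^ d) (fun k => (regionDeltaA (lev L k) M a a' S)⁻¹)
      (Cpert 0 (Real.sqrt (CgI₀ / 2 * (gamStar d a' c)⁻¹)) C₁ 0 0 0) θ := by
  have hL0 : (L : ℝ) ≠ 0 := by exact_mod_cast NeZero.ne L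
  set γ := gamStar d a' c with hγdef
  have hγ : 0 < γ := DirichletStarVectorTower.gamStar_pos (d := d) a' hc
  set E : ℕ → ℝ := fun k => 1 / 2 * (L : ℝ) ^ 2 * ((((lev L (k + 1) : ℕ) : ℝ)) ^ 2)⁻¹ * CgI k with hEdef
  have hE : ∀ k, 0 ≤ E k := fun k => by have := hCg0 k; positivity
  have h₀ : ∀ k, Real.sqrt (E k * γ⁻¹) ≤ Real.sqrt (CgI₀ / 2 * γ⁻¹) * θ ^ k := by
    intro k
    have hLk : (0 : ℝ) < ((L : ℝ) ^ k) ^ 2 := by positivity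
    have e1 : E k = 1 / 2 * ((((L : ℝ) ^ k) ^ 2)⁻¹ * CgI k) := by
      simp only [hEdef]
      rw [cast_lev' L (k + 1), pow_succ (L : ℝ) k, mul_assoc (1 / 2 : ℝ) ((L : ℝ) ^ 2), sq_mul_inv_sq L hL0 k, mul_assoc]
    have e2 : (((L : ℝ) ^ k) ^ 2)⁻¹ * CgI k ≤ CgI₀ * (θ ^ k) ^ 2 := by
      rw [inv_mul_le_iff₀ hLk]
      calc CgI k ≤ CgI₀ * (((L : ℝ) * θ) ^ k) ^ 2 := hCg k
        _ = ((L : ℝ) ^ k) ^ 2 * (CgI₀ * (θ ^ k) ^ 2) := by rw [mul_pow, mul_pow]; ring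
    have e3 : E k * γ⁻¹ ≤ CgI₀ / 2 * γ⁻¹ * (θ ^ k) ^ 2 := by
      rw [e1]
      have h4 := mul_le_mul_of_nonneg_right (mul_le_mul_of_nonneg_left e2 (by norm_num : (0 : ℝ) ≤ 1 / 2)) (inv_nonneg.mpr hγ.le)
      linarith [h4]
    calc Real.sqrt (E k * γ⁻¹) ≤ Real.sqrt (CgI₀ / 2 * γ⁻¹ * (θ ^ k) ^ 2) := Real.sqrt_le_sqrt e3
      _ = Real.sqrt (CgI₀ / 2 * γ⁻¹) * θ ^ k := by rw [Real.sqrt_mul' _ (sq_nonneg _), Real.sqrt_sq (pow_nonneg hθ0 k)]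
  exact DirichletStarRenormTower.towerLimitRate_star_renorm_of L M S a a' ha' hc hS hE
    (fun k w => poincareForm_of_interior L M S k _ (hI k) w) hθ1 h₀ hinj

end End

end Summit.QuantumFields.BalabanUV.T4Continuum.DirichletStarClassPoincare

end
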